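import Literature.MathematicalPhysics.QuantumFieldTheory.Balaban1983to89.T4StairWordSystemCubeTreeGlue

/-!
# `Balaban1983to89.T4StairWordSystemCubeTreeInduction` — THE TREE-OF-BOXES WORD SYSTEM, III: the gluing step ITERATED along a finite tree of boxes (root box behind a hub
# word, box `i ≥ 1` attached to an earlier box `p i < i` through an entry site), in the ONE-BOND-BOUND currency — the constant is the same at every depth

Cell `pub-ymgap` (Track A DAG, node N12 = [B15] = T. Bałaban, *Large field renormalization. I*, Commun. Math. Phys. **122** (1989) 175–202 [Balaban1989LargeFieldI]),
width seat `dag-n12-w2` (g5), piece (R1) §3 (lane word dag-n12-c g19, cell bus l.37564: *«then box ∪ (tree of boxes) glued along a face iterates by the same lemma and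
`hgauge` follows for every Z-component whose k-shadow is a face-connected TREE of parallelepipeds»*).  Count-neutral Literature helper.  HONEST FRAMING: an induction over
`T4StairWordSystemCubeTree.boxWords_bondBound` (root) and `T4StairWordSystemCubeTreeGlue.treeGlue_union_bondBound` (step) BY NAME — lattice ∕ gauge bookkeeping on the tree's
own objects; nothing of Bałaban's estimates ((1.7) ∕ (2.14) plaquette smallness, [15] Thm 1, Proposition 1, the datum side) is asserted; N12 is NOT discharged by this file;
one finite `𝕋⁴` programme at fixed `ε`; nothing here bears on the continuum ∕ OS ∕ mass-gap statement.

THE DATA (all displayed).  Boxes `Q_i = castSite '' [A i, B i]`, `i ∈ ℕ`, each with at most `m + 1` sites per direction, non-wrapping, box coordinates `rep i`, an axis order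
`σ i` whose FIRST axis is `μ i`; a configuration `U` with `PlaqSmallOn S δ U`; ONE word function `W`.  ROOT (`i = 0`): a hub word `ρ` from `r` to `castSite h̃`, `h̃ ∈ [A 0 − 1,
B 0 + 1]`, `W x = ρ ++ stairWord (σ 0) (rep 0 x − h̃)` on `Q_0`, and §1's sharp plaquette box of `Q_0` at `h̃` (axis `μ 0`) inside `S`.  CHILD `i ≥ 1`: a parent `p i < i`, an entry
`f i ∈ [A (p i), B (p i)] ∩ [A i − 1, B i + 1]`, separation of `Q_{p i}` and `Q_i` in the axis `μ i`, joint non-wrapping, `W x = W(castSite (f i)) ++ stairWord (σ i) (rep i x − f i)`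
on `Q_i`, `Q_i` touching `⋃_{k<i} Q_k` only through `Q_{p i}` (both orientations), and the two located plaquette boxes (§1's sharp box of `Q_i` at `f i`; §3's cross box of
`Q_{p i}` at `f i`) inside `S`.

WHAT IS PROVED (no `def`, no `sorry`; `G` any `GaugeGroup`): `mem_iUnion_lt_succ`, `sharpBox_subset_of_central`, `crossBox_subset_of_central` (bookkeeping); ★ `exists_treeWords`
(the word function `W` with the displayed recursive equations EXISTS for pairwise disjoint boxes — the caller need not define it); ★★★
`treeOfBoxes_bondBound` — for every `n`: (i) every word of
`⋃_{i<n} Q_i` ends at its site; (ii) every box `Q_i`, `i < n`, satisfies (INV) on its own bonds with `K_box(m) = (2(d(m+1)+1)+1)²∕4`; (iii) (INV) holds on all bonds of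
`⋃_{i<n} Q_i` with the depth-independent constant `max K_box(m) K_cross(m)`, `K_cross(m) = d(m+1)·K_box(m) + (2d(m+1)+1)²∕4` — the letter `hab` of
`T4WordSystemGaugeBound.exists_gauge_one_on_nearFlat_of_bondBound` ∕ the hypothesis `hinv` of `exists_gauge_normalising_extend_of_bondBoundSystem_le` (file II §4) for
`X = ⋃_{i<n} Q_i`, once the caller's located boxes lie in `Z^{(k)}` (the knit's collar inclusion); ★★★ `treeOfBoxes_bondBound_central` — THE CUBE-TEMPLATE EDITION:
with the root hub and every entry NEAR-CENTRAL transversally (`|2f̃_κ − (A_κ + B_κ)| ≤ 1`, e.g. aligned equal cubes entered through face-layer centres) the located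
hypotheses collapse to ONE plaquette box per box, `boxPlaqs (A i − 2) (B i + 4) ⊆ S`.
HONEST SCOPE (LOCATED-GEOM v2 ∕ v3 unchanged): trees of parallelepipeds, each new box touching the union of the earlier ones only through its parent; ring-shaped `Ω₁(Z)` stay
vacuous-by-shape (dag-n12-c's `B15Prop1HolonomyObstruction`).

References: T. Bałaban, CMP 122 (1989) 175–202 [Balaban1989LargeFieldI] (p.194); CMP 98 (1985) 17–51 [Balaban1985Averaging] ((8)–(9) p.19, (19)–(20) p.21);
CMP 109 (1987) 249–301 [Balaban1987RG1] ((0.3) p.252); J. Math. Phys. 26 (1985) [Balaban1985RegularSpaces] ((1.19) p.79).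
-/

noncomputable section

open Set

namespace Literature.MathematicalPhysics.QuantumFieldTheory.Balaban1983to89.T4StairWordSystemCubeTreeInduction

open T4Continuum T4ReflectionCone
open T4AxialGaugeSmallField (castSite boxPlaqs)
open T4StairWordSystemCubeTree (boxWords_bondBound)
open T4StairWordSystemCubeTreeGlue (treeGlue_union_bondBound)

variable {P : Params} {j : ℕ}

/-- Bookkeeping: `⋃_{i < n+1} Q_i = (⋃_{i < n} Q_i) ∪ Q_n`, membership form. [cite: Balaban1985Averaging, (3)-(5) p.18 (the torus as a quotient lattice; bookkeeping)] -/
theorem mem_iUnion_lt_succ {α : Type*} (Q : ℕ → Set α) (n : ℕ) (x : α) :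
    (x ∈ ⋃ i < n + 1, Q i) ↔ (x ∈ ⋃ i < n, Q i) ∨ x ∈ Q n := by
  simp only [Set.mem_iUnion, exists_prop]
  constructor
  · rintro ⟨i, hi, hx⟩
    rcases Nat.lt_succ_iff_lt_or_eq.1 hi with h | rfl
    · exact Or.inl ⟨i, h, hx⟩
    · exact Or.inr hx
  · rintro (⟨i, hi, hx⟩ | hx)
    · exact ⟨i, Nat.lt_succ_of_lt hi, hx⟩
    · exact ⟨n, Nat.lt_succ_self n, hx⟩

/-- **THE TREE'S WORD FUNCTION EXISTS** (so the caller need not define it): for pairwise DISJOINT boxes and entries `castSite (f i) ∈ Q_{p i}`, `p i < i`, there is ONE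
`W : Site → List Letter` with `W x = ρ ++ stairWord (σ 0) (rep 0 x − h̃)` on `Q_0` and `W x = W(castSite (f i)) ++ stairWord (σ i) (rep i x − f i)` on every `Q_i`, `i ≥ 1`
(strong recursion on the box index; the box of a site is unique by disjointness). [cite: Balaban1987RG1, (0.3) p.252; Balaban1985RegularSpaces, (1.19) p.79 (axial gauges of trees)] -/
theorem exists_treeWords (A B : ℕ → Fin P.d → ℤ) (rep : ℕ → Site P j → Fin P.d → ℤ) (σ : ℕ → Equiv.Perm (Fin P.d))
    (ρ : List (Letter P.d)) (h : Fin P.d → ℤ) (p : ℕ → ℕ) (hp : ∀ i, 1 ≤ i → p i < i) (f : ℕ → Fin P.d → ℤ)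
    (hfQ : ∀ i, 1 ≤ i → (castSite (f i) : Site P j) ∈ (castSite '' Set.Icc (A (p i)) (B (p i)) : Set (Site P j)))
    (hdisj : ∀ i k, i ≠ k → Disjoint (castSite '' Set.Icc (A i) (B i) : Set (Site P j)) (castSite '' Set.Icc (A k) (B k))) :
    ∃ W : Site P j → List (Letter P.d),
      (∀ x ∈ (castSite '' Set.Icc (A 0) (B 0) : Set (Site P j)), W x = ρ ++ stairWord (σ 0) (rep 0 x - h)) ∧
      (∀ i, 1 ≤ i → ∀ x ∈ (castSite '' Set.Icc (A i) (B i) : Set (Site P j)), W x = W (castSite (f i)) ++ stairWord (σ i) (rep i x - f i)) := by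
  classical
  let F : ∀ i : ℕ, (∀ m : ℕ, m < i → (Site P j → List (Letter P.d))) → (Site P j → List (Letter P.d)) :=
    fun i ih x => if hi : i = 0 then ρ ++ stairWord (σ 0) (rep 0 x - h)
      else ih (p i) (hp i (Nat.one_le_iff_ne_zero.2 hi)) (castSite (f i)) ++ stairWord (σ i) (rep i x - f i)
  obtain ⟨wordOf, hw⟩ : ∃ wordOf : ℕ → Site P j → List (Letter P.d), ∀ i x, wordOf i x =
      if i = 0 then ρ ++ stairWord (σ 0) (rep 0 x - h) else wordOf (p i) (castSite (f i)) ++ stairWord (σ i) (rep i x - f i) := by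
    refine ⟨fun i => Nat.strongRec (motive := fun _ => Site P j → List (Letter P.d)) F i, fun i x => ?_⟩
    have e := Nat.strongRec_eq (motive := fun _ => Site P j → List (Letter P.d)) F i
    beta_reduce
    rw [e]
    by_cases hi : i = 0
    · simp only [F, dif_pos hi, if_pos hi]
    · simp only [F, dif_neg hi, if_neg hi]
  have hidx : ∀ i (x : Site P j), x ∈ (castSite '' Set.Icc (A i) (B i) : Set (Site P j)) →
      ∀ (hx : ∃ k, x ∈ (castSite '' Set.Icc (A k) (B k) : Set (Site P j))), Nat.find hx = i := by
    intro i x hxi hx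
    rw [Nat.find_eq_iff]
    refine ⟨hxi, fun k hk hxk => ?_⟩
    exact Set.disjoint_left.1 (hdisj k i (by omega)) hxk hxi
  refine ⟨fun x => if hx : ∃ k, x ∈ (castSite '' Set.Icc (A k) (B k) : Set (Site P j)) then wordOf (Nat.find hx) x else [],
    fun x hx => ?_, fun i hi x hx => ?_⟩
  · have hex : ∃ k, x ∈ (castSite '' Set.Icc (A k) (B k) : Set (Site P j)) := ⟨0, hx⟩
    simp only [dif_pos hex, hidx 0 x hx hex]
    rw [hw 0 x, if_pos rfl]
  · have hex : ∃ k, x ∈ (castSite '' Set.Icc (A k) (B k) : Set (Site P j)) := ⟨i, hx⟩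
    have hexf : ∃ k, (castSite (f i) : Site P j) ∈ (castSite '' Set.Icc (A k) (B k) : Set (Site P j)) := ⟨p i, hfQ i hi⟩
    simp only [dif_pos hex, dif_pos hexf, hidx i x hx hex, hidx (p i) _ (hfQ i hi) hexf]
    rw [hw i x, if_neg (by omega)]

variable {G : Type*} [GaugeGroup G]

/-- ★★★ **(INV) ALONG A TREE OF BOXES, WITH A DEPTH-INDEPENDENT CONSTANT** (the gluing step of file II iterated; data as in the file header).  For every `n`: (i) the words of the
sites of `⋃_{i<n} Q_i` end at their sites; (ii) each `Q_i`, `i < n`, satisfies (INV) on its own bonds with `K_box(m)`; (iii) every bond with both ends in `⋃_{i<n} Q_i` satisfies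
(INV) with `max K_box(m) K_cross(m)`.  Induction: the root by `boxWords_bondBound`; the step by `treeGlue_union_bondBound` with `X = ⋃_{i<n} Q_i`, parent `Q_{p n} ⊆ X` carrying
`K_box(m)` from (ii) — so `max K (max K_box K_cross) = K` and the constant never grows. [cite: Balaban1989LargeFieldI, p.194 (sentence after (1.77)); Balaban1985Averaging, (8)-(9) p.19 and (19)-(20) p.21; Balaban1987RG1, (0.3) p.252] -/
theorem treeOfBoxes_bondBound (U : GaugeField P j G) {S : Set (Plaq P j)} {δ : ℝ} (hδ : 0 ≤ δ) (hU : PlaqSmallOn S δ U)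
    (r : Site P j) (W : Site P j → List (Letter P.d))
    (A B : ℕ → Fin P.d → ℤ) {m : ℕ} (hm : ∀ i κ, B i κ ≤ A i κ + m) (hN : ∀ i κ, B i κ - A i κ + 3 < (P.sitesPerDir j : ℤ))
    (hmN : 2 * (P.d * (m + 1) + 1) + 1 < P.sitesPerDir j)
    (rep : ℕ → Site P j → Fin P.d → ℤ)
    (hrep : ∀ i, ∀ x ∈ (castSite '' Set.Icc (A i) (B i) : Set (Site P j)), A i ≤ rep i x ∧ rep i x ≤ B i ∧ (castSite (rep i x) : Site P j) = x)
    (σ : ℕ → Equiv.Perm (Fin P.d)) (μ : ℕ → Fin P.d) (hσ : ∀ i, ∃ rest, (List.finRange P.d).map (σ i) = μ i :: rest)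
    (ρ : List (Letter P.d)) {h : Fin P.d → ℤ} (hhA : A 0 - 1 ≤ h) (hhB : h ≤ B 0 + 1) (hρ : walkEnd r ρ = castSite h)
    (hW0 : ∀ x ∈ (castSite '' Set.Icc (A 0) (B 0) : Set (Site P j)), W x = ρ ++ stairWord (σ 0) (rep 0 x - h))
    (hS0 : (boxPlaqs (fun κ => (if κ = μ 0 then A 0 κ else min (A 0 κ) (2 * h κ - B 0 κ)) - 1)
              (fun κ => (if κ = μ 0 then B 0 κ else max (B 0 κ) (2 * h κ - A 0 κ)) + 3) : Set (Plaq P j)) ⊆ S)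
    (p : ℕ → ℕ) (hp : ∀ i, 1 ≤ i → p i < i) (f : ℕ → Fin P.d → ℤ)
    (hfA : ∀ i, 1 ≤ i → A (p i) ≤ f i) (hfB : ∀ i, 1 ≤ i → f i ≤ B (p i))
    (hfA' : ∀ i, 1 ≤ i → A i - 1 ≤ f i) (hfB' : ∀ i, 1 ≤ i → f i ≤ B i + 1)
    (hNN : ∀ i, 1 ≤ i → ∀ κ, max (B (p i) κ) (B i κ) + 1 - min (A (p i) κ) (A i κ) < (P.sitesPerDir j : ℤ))
    (hsep : ∀ i, 1 ≤ i → B (p i) (μ i) < A i (μ i) ∨ B i (μ i) < A (p i) (μ i))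
    (hWi : ∀ i, 1 ≤ i → ∀ x ∈ (castSite '' Set.Icc (A i) (B i) : Set (Site P j)), W x = W (castSite (f i)) ++ stairWord (σ i) (rep i x - f i))
    (htouch : ∀ i, 1 ≤ i → ∀ (s : Site P j) (ν : Fin P.d), (s ∈ ⋃ k < i, (castSite '' Set.Icc (A k) (B k) : Set (Site P j))) →
      s.shift ν ∈ (castSite '' Set.Icc (A i) (B i) : Set (Site P j)) → s ∈ (castSite '' Set.Icc (A (p i)) (B (p i)) : Set (Site P j)))
    (htouch' : ∀ i, 1 ≤ i → ∀ (s : Site P j) (ν : Fin P.d), s ∈ (castSite '' Set.Icc (A i) (B i) : Set (Site P j)) →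
      (s.shift ν ∈ ⋃ k < i, (castSite '' Set.Icc (A k) (B k) : Set (Site P j))) → s.shift ν ∈ (castSite '' Set.Icc (A (p i)) (B (p i)) : Set (Site P j)))
    (hSin : ∀ i, 1 ≤ i → (boxPlaqs (fun κ => (if κ = μ i then A i κ else min (A i κ) (2 * f i κ - B i κ)) - 1)
              (fun κ => (if κ = μ i then B i κ else max (B i κ) (2 * f i κ - A i κ)) + 3) : Set (Plaq P j)) ⊆ S)
    (hScross : ∀ i, 1 ≤ i → (boxPlaqs (fun κ => if κ = μ i then f i (μ i) - 1 else min (A (p i) κ) (2 * f i κ - B (p i) κ))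
              (fun κ => if κ = μ i then f i (μ i) + 3 else max (B (p i) κ) (2 * f i κ - A (p i) κ) + 2) : Set (Plaq P j)) ⊆ S) :
    ∀ n : ℕ,
      (∀ x ∈ ⋃ i < n, (castSite '' Set.Icc (A i) (B i) : Set (Site P j)), walkEnd r (W x) = x) ∧
      (∀ i < n, ∀ (s : Site P j) (ν : Fin P.d), s ∈ (castSite '' Set.Icc (A i) (B i) : Set (Site P j)) →
        s.shift ν ∈ (castSite '' Set.Icc (A i) (B i) : Set (Site P j)) →
          dist1 (holAt U (walk r (W s)) * U ⟨s, ν⟩ * (holAt U (walk r (W (s.shift ν))))⁻¹) ≤ (((2 * (P.d * (m + 1) + 1) + 1 : ℕ) : ℝ) ^ 2 / 4) * δ) ∧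
      (∀ (s : Site P j) (ν : Fin P.d), (s ∈ ⋃ i < n, (castSite '' Set.Icc (A i) (B i) : Set (Site P j))) →
        (s.shift ν ∈ ⋃ i < n, (castSite '' Set.Icc (A i) (B i) : Set (Site P j))) →
          dist1 (holAt U (walk r (W s)) * U ⟨s, ν⟩ * (holAt U (walk r (W (s.shift ν))))⁻¹)
            ≤ max ((((2 * (P.d * (m + 1) + 1) + 1 : ℕ) : ℝ) ^ 2 / 4))
                (((P.d * (max m m + 1) : ℕ) : ℝ) * ((((2 * (P.d * (m + 1) + 1) + 1 : ℕ) : ℝ) ^ 2 / 4))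
                  + ((2 * (P.d * (max m m + 1)) + 1 : ℕ) : ℝ) ^ 2 / 4) * δ) := by
  set Kb : ℝ := (((2 * (P.d * (m + 1) + 1) + 1 : ℕ) : ℝ) ^ 2 / 4) with hKb
  set Kc : ℝ := (((P.d * (max m m + 1) : ℕ) : ℝ) * Kb + ((2 * (P.d * (max m m + 1)) + 1 : ℕ) : ℝ) ^ 2 / 4) with hKc
  have hKb0 : 0 ≤ Kb := by positivity
  intro n
  induction n with
  | zero =>
    refine ⟨fun x hx => ?_, fun i hi => absurd hi (Nat.not_lt_zero i), fun s ν hs => ?_⟩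
    · simp at hx
    · simp at hs
  | succ n ih =>
    obtain ⟨hend, hbox, hall⟩ := ih
    rcases Nat.eq_zero_or_pos n with rfl | hn
    · -- the root box alone
      obtain ⟨hend0, -, hbd0⟩ := boxWords_bondBound U hδ hU (σ 0) (hσ 0) hhA hhB (hN 0) (hm 0) hmN (rep 0) (hrep 0) r ρ hρ W hW0 hS0
      have hmem : ∀ x : Site P j, (x ∈ ⋃ i < 0 + 1, (castSite '' Set.Icc (A i) (B i) : Set (Site P j))) ↔
          x ∈ (castSite '' Set.Icc (A 0) (B 0) : Set (Site P j)) := fun x => by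
        rw [mem_iUnion_lt_succ]; simp
      refine ⟨fun x hx => hend0 x ((hmem x).1 hx), fun i hi => ?_, fun s ν hs ht => ?_⟩
      · have hi0 : i = 0 := by omega
        subst hi0; exact hbd0
      · exact (hbd0 s ν ((hmem s).1 hs) ((hmem _).1 ht)).trans (mul_le_mul_of_nonneg_right (le_max_left _ _) hδ)
    · -- glue the box `n` to `X = ⋃_{i<n} Q_i` through its parent `p n < n`
      have h1n : 1 ≤ n := hn
      have hpn : p n < n := hp n h1n
      have hQX : (castSite '' Set.Icc (A (p n)) (B (p n)) : Set (Site P j)) ⊆ ⋃ i < n, (castSite '' Set.Icc (A i) (B i) : Set (Site P j)) :=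
        fun x hx => Set.mem_iUnion₂.2 ⟨p n, hpn, hx⟩
      have hmN' : 2 * (P.d * (max m m + 1) + 1) + 1 < P.sitesPerDir j := by rwa [max_self]
      obtain ⟨hend', -, hbd', hall'⟩ := treeGlue_union_bondBound U hδ hU r (⋃ i < n, (castSite '' Set.Icc (A i) (B i) : Set (Site P j))) W
        hend hall hQX (hm (p n)) hKb0 (hbox (p n) hpn) (hm n) (rep n) (hrep n) (hN n) (hNN n h1n) (μ n) (hsep n h1n)
        (hfA n h1n) (hfB n h1n) (hfA' n h1n) (hfB' n h1n) (σ n) (hσ n) hmN' (htouch n h1n) (htouch' n h1n) W (fun x _ => rfl) (hWi n h1n)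
        (hSin n h1n) (hScross n h1n)
      refine ⟨fun x hx => ?_, fun i hi => ?_, fun s ν hs ht => ?_⟩
      · rcases (mem_iUnion_lt_succ _ n x).1 hx with hx | hx
        · exact hend' x (Or.inl hx)
        · exact hend' x (Or.inr hx)
      · rcases Nat.lt_succ_iff_lt_or_eq.1 hi with hi | rfl
        · exact hbox i hi
        · exact hbd'
      · have hs' := (mem_iUnion_lt_succ _ n s).1 hs
        have ht' := (mem_iUnion_lt_succ _ n (s.shift ν)).1 ht
        refine (hall' s ν hs' ht').trans (mul_le_mul_of_nonneg_right (max_le le_rfl le_rfl) hδ)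

/-- Bookkeeping for near-central entries: if `r̃ ∈ [A − 1, B + 1]` in the axis `μ` and `|2r̃_κ − (A_κ + B_κ)| ≤ 1` in the other axes, §1's sharp plaquette box of `[A, B]` at `r̃`
lies in the box enlarged by `2` below and `4` above. [cite: Balaban1985Averaging, (19)-(20) p.21 (bookkeeping of the located Stokes bound)] -/
theorem sharpBox_subset_of_central {A B r : Fin P.d → ℤ} {μ : Fin P.d} (hcen : ∀ κ, κ ≠ μ → |2 * r κ - (A κ + B κ)| ≤ 1) :
    (boxPlaqs (fun κ => (if κ = μ then A κ else min (A κ) (2 * r κ - B κ)) - 1)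
        (fun κ => (if κ = μ then B κ else max (B κ) (2 * r κ - A κ)) + 3) : Set (Plaq P j)) ⊆ boxPlaqs (A - 2) (B + 4) := by
  refine T4StairWordPrefix.boxPlaqs_mono (fun κ => ?_) (fun κ => ?_)
  · show (A - 2) κ ≤ (if κ = μ then A κ else min (A κ) (2 * r κ - B κ)) - 1
    have e2 : (A - 2) κ = A κ - 2 := by simp
    rw [e2]
    split_ifs with hκ
    · linarith
    · have h := (abs_le.1 (hcen κ hκ)).1
      have : A κ - 1 ≤ min (A κ) (2 * r κ - B κ) := le_min (by linarith) (by linarith)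
      linarith
  · show (if κ = μ then B κ else max (B κ) (2 * r κ - A κ)) + 3 ≤ (B + 4) κ
    have e4 : (B + 4) κ = B κ + 4 := by simp
    rw [e4]
    split_ifs with hκ
    · linarith
    · have h := (abs_le.1 (hcen κ hκ)).2
      have : max (B κ) (2 * r κ - A κ) ≤ B κ + 1 := max_le (by linarith) (by linarith)
      linarith

/-- Bookkeeping for near-central entries: if `f̃ ∈ [A, B]` and `|2f̃_κ − (A_κ + B_κ)| ≤ 1` off the axis `μ`, §3's cross box of `[A, B]` at `f̃` lies in the box enlarged by `2` below
and `4` above. [cite: Balaban1985Averaging, (19)-(20) p.21 (bookkeeping of the located Stokes bound)] -/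
theorem crossBox_subset_of_central {A B f : Fin P.d → ℤ} {μ : Fin P.d} (hfA : A ≤ f) (hfB : f ≤ B) (hcen : ∀ κ, κ ≠ μ → |2 * f κ - (A κ + B κ)| ≤ 1) :
    (boxPlaqs (fun κ => if κ = μ then f μ - 1 else min (A κ) (2 * f κ - B κ))
        (fun κ => if κ = μ then f μ + 3 else max (B κ) (2 * f κ - A κ) + 2) : Set (Plaq P j)) ⊆ boxPlaqs (A - 2) (B + 4) := by
  refine T4StairWordPrefix.boxPlaqs_mono (fun κ => ?_) (fun κ => ?_)
  · show (A - 2) κ ≤ (if κ = μ then f μ - 1 else min (A κ) (2 * f κ - B κ))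
    have e2 : (A - 2) κ = A κ - 2 := by simp
    rw [e2]
    split_ifs with hκ
    · subst hκ; have := hfA κ; linarith
    · have h := (abs_le.1 (hcen κ hκ)).1
      have : A κ - 1 ≤ min (A κ) (2 * f κ - B κ) := le_min (by linarith) (by linarith)
      linarith
  · show (if κ = μ then f μ + 3 else max (B κ) (2 * f κ - A κ) + 2) ≤ (B + 4) κ
    have e4 : (B + 4) κ = B κ + 4 := by simp
    rw [e4]
    split_ifs with hκ
    · subst hκ; have := hfB κ; linarith
    · have h := (abs_le.1 (hcen κ hκ)).2
      have : max (B κ) (2 * f κ - A κ) ≤ B κ + 1 := max_le (by linarith) (by linarith)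
      linarith

/-- ★★★ **THE CUBE-TEMPLATE EDITION: NEAR-CENTRAL ENTRIES, ONE PLAQUETTE BOX PER BOX.**  As `treeOfBoxes_bondBound`, with the root hub `h̃` and every entry `f i` NEAR-CENTRAL in the
transverse directions of the boxes they serve (`|2f̃_κ − (A_κ + B_κ)| ≤ 1` off the gluing axis, w.r.t. the child AND the parent — e.g. aligned equal cubes of a cubic tiling entered
through face-layer centres), the located hypotheses collapse to ONE box per box: `boxPlaqs (A i − 2) (B i + 4) ⊆ S` (each box widened by two layers below, two layers plus the
plaquette reach above) — the form the knit discharges from the collar of [Balaban1989LargeFieldIII] (2.1)–(2.2). [cite: Balaban1989LargeFieldI, p.194 (sentence after (1.77)); Balaban1985Averaging, (19)-(20) p.21; Balaban1987RG1, (0.3) p.252] -/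
theorem treeOfBoxes_bondBound_central (U : GaugeField P j G) {S : Set (Plaq P j)} {δ : ℝ} (hδ : 0 ≤ δ) (hU : PlaqSmallOn S δ U)
    (r : Site P j) (W : Site P j → List (Letter P.d))
    (A B : ℕ → Fin P.d → ℤ) {m : ℕ} (hm : ∀ i κ, B i κ ≤ A i κ + m) (hN : ∀ i κ, B i κ - A i κ + 3 < (P.sitesPerDir j : ℤ))
    (hmN : 2 * (P.d * (m + 1) + 1) + 1 < P.sitesPerDir j)
    (rep : ℕ → Site P j → Fin P.d → ℤ)
    (hrep : ∀ i, ∀ x ∈ (castSite '' Set.Icc (A i) (B i) : Set (Site P j)), A i ≤ rep i x ∧ rep i x ≤ B i ∧ (castSite (rep i x) : Site P j) = x)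
    (σ : ℕ → Equiv.Perm (Fin P.d)) (μ : ℕ → Fin P.d) (hσ : ∀ i, ∃ rest, (List.finRange P.d).map (σ i) = μ i :: rest)
    (ρ : List (Letter P.d)) {h : Fin P.d → ℤ} (hhA : A 0 - 1 ≤ h) (hhB : h ≤ B 0 + 1) (hρ : walkEnd r ρ = castSite h)
    (hhcen : ∀ κ, κ ≠ μ 0 → |2 * h κ - (A 0 κ + B 0 κ)| ≤ 1)
    (hW0 : ∀ x ∈ (castSite '' Set.Icc (A 0) (B 0) : Set (Site P j)), W x = ρ ++ stairWord (σ 0) (rep 0 x - h))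
    (p : ℕ → ℕ) (hp : ∀ i, 1 ≤ i → p i < i) (f : ℕ → Fin P.d → ℤ)
    (hfA : ∀ i, 1 ≤ i → A (p i) ≤ f i) (hfB : ∀ i, 1 ≤ i → f i ≤ B (p i))
    (hfA' : ∀ i, 1 ≤ i → A i - 1 ≤ f i) (hfB' : ∀ i, 1 ≤ i → f i ≤ B i + 1)
    (hfcen : ∀ i, 1 ≤ i → ∀ κ, κ ≠ μ i → |2 * f i κ - (A i κ + B i κ)| ≤ 1 ∧ |2 * f i κ - (A (p i) κ + B (p i) κ)| ≤ 1)
    (hNN : ∀ i, 1 ≤ i → ∀ κ, max (B (p i) κ) (B i κ) + 1 - min (A (p i) κ) (A i κ) < (P.sitesPerDir j : ℤ))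
    (hsep : ∀ i, 1 ≤ i → B (p i) (μ i) < A i (μ i) ∨ B i (μ i) < A (p i) (μ i))
    (hWi : ∀ i, 1 ≤ i → ∀ x ∈ (castSite '' Set.Icc (A i) (B i) : Set (Site P j)), W x = W (castSite (f i)) ++ stairWord (σ i) (rep i x - f i))
    (htouch : ∀ i, 1 ≤ i → ∀ (s : Site P j) (ν : Fin P.d), (s ∈ ⋃ k < i, (castSite '' Set.Icc (A k) (B k) : Set (Site P j))) →
      s.shift ν ∈ (castSite '' Set.Icc (A i) (B i) : Set (Site P j)) → s ∈ (castSite '' Set.Icc (A (p i)) (B (p i)) : Set (Site P j)))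
    (htouch' : ∀ i, 1 ≤ i → ∀ (s : Site P j) (ν : Fin P.d), s ∈ (castSite '' Set.Icc (A i) (B i) : Set (Site P j)) →
      (s.shift ν ∈ ⋃ k < i, (castSite '' Set.Icc (A k) (B k) : Set (Site P j))) → s.shift ν ∈ (castSite '' Set.Icc (A (p i)) (B (p i)) : Set (Site P j)))
    (hS : ∀ i, (boxPlaqs (A i - 2) (B i + 4) : Set (Plaq P j)) ⊆ S) :
    ∀ n : ℕ,
      (∀ x ∈ ⋃ i < n, (castSite '' Set.Icc (A i) (B i) : Set (Site P j)), walkEnd r (W x) = x) ∧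
      (∀ i < n, ∀ (s : Site P j) (ν : Fin P.d), s ∈ (castSite '' Set.Icc (A i) (B i) : Set (Site P j)) →
        s.shift ν ∈ (castSite '' Set.Icc (A i) (B i) : Set (Site P j)) →
          dist1 (holAt U (walk r (W s)) * U ⟨s, ν⟩ * (holAt U (walk r (W (s.shift ν))))⁻¹) ≤ (((2 * (P.d * (m + 1) + 1) + 1 : ℕ) : ℝ) ^ 2 / 4) * δ) ∧
      (∀ (s : Site P j) (ν : Fin P.d), (s ∈ ⋃ i < n, (castSite '' Set.Icc (A i) (B i) : Set (Site P j))) →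
        (s.shift ν ∈ ⋃ i < n, (castSite '' Set.Icc (A i) (B i) : Set (Site P j))) →
          dist1 (holAt U (walk r (W s)) * U ⟨s, ν⟩ * (holAt U (walk r (W (s.shift ν))))⁻¹)
            ≤ max ((((2 * (P.d * (m + 1) + 1) + 1 : ℕ) : ℝ) ^ 2 / 4))
                (((P.d * (max m m + 1) : ℕ) : ℝ) * ((((2 * (P.d * (m + 1) + 1) + 1 : ℕ) : ℝ) ^ 2 / 4))
                  + ((2 * (P.d * (max m m + 1)) + 1 : ℕ) : ℝ) ^ 2 / 4) * δ) :=
  treeOfBoxes_bondBound U hδ hU r W A B hm hN hmN rep hrep σ μ hσ ρ hhA hhB hρ hW0 ((sharpBox_subset_of_central hhcen).trans (hS 0))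
    p hp f hfA hfB hfA' hfB' hNN hsep hWi htouch htouch'
    (fun i hi => (sharpBox_subset_of_central fun κ hκ => ((hfcen i hi κ hκ).1)).trans (hS i))
    (fun i hi => (crossBox_subset_of_central (hfA i hi) (hfB i hi) fun κ hκ => (hfcen i hi κ hκ).2).trans (hS (p i)))

end Literature.MathematicalPhysics.QuantumFieldTheory.Balaban1983to89.T4StairWordSystemCubeTreeInduction

end
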